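import Summits.QuantumFields.BalabanUV.T4Continuum.E3Cert.ZL2d4C0half.Data

/-!
# Gaps / E3BlockD4VortexWitness — the d = 4 ALL-U block bound FAILS: an exact ℤ₂-vortex Rayleigh witness for the
# (d, L, k) = (4, 2, 1) one-block operator of [B4] (1.3)–(1.6), evaluated on the TREE polynomial `E3Z.zL2d4C0half_quadH`

HONEST FRAMING (cell pub-balaban-gaps, seat g1-p3; page 1 of everything): this is CERTIFIED FINITE ARITHMETIC on ONE 2⁴ block
in the E3 lane's scalar-charged quaternion surrogate of Bałaban's covariant block operator `H(U) = η⁻²K_U + a·η^{−d}A_UᵀA_U`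
([Balaban1983RegularityDecay] = B4, CMP **89** (1983), p. 572 (1.3)–(1.6); target shape (1.8) p. 573 «−Δ_A + aP_k(A) ≥ γ₀I … γ₀
independent of η, Ω and A» for REGULAR fields A).  It is NOT a statement about Prop. (1.8) as printed (which assumes a small ∕ regular
field), NOT an input of any NE row, NOT continuum, NOT Clay.  WHAT IT SHOWS: the background-UNIFORM form of the block inequality —
«λ_min(H(U)) ≥ γ₀ = a for EVERY U», true and kernel-certified in d = 2, 3 on the blocks (2,2,1), (2,3,1), (3,2,1), (2,2,2) (tree packages
`E3Cert/ZL2d2AllU`, `ZL3d2AllU`, `ZL2d3AllU`, γ = 1021∕1024 resp. 511∕512, 511∕512) — is FALSE in d = 4 already at k = 1: one ℤ₂ vortex (ONE link `U_b = −1`,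
3 of the block's 24 plaquettes frustrated) pushes the Rayleigh quotient below `a = 1`, indeed below the small-field certificate's
`γ = 923∕1024` (`E3Cert/ZL2d4C0half`, hypothesis `(u_t)₀ ≥ ½` on every free link) and down to `≤ 0.60845` (the lane's exact value:
λ_min = 0.6084460056… = least root of `x⁴ − 56x³ + 992x² − 5632x + 3072`, CENSUS-TABLE row «08-20 11:27Z (4,2,1) ALL of SU(2) EXACT−»;
the quartic is EVIDENCE here, not proved).  CONSEQUENCE (kernel, `smallField_hypothesis_necessary`): the small-field hypotheses `hin` of
`E3Z.zL2d4C0half_nonneg` cannot be dropped — B4's regularity hypothesis in (1.8) is load-bearing exactly in the physical dimension on this block.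

THE OBJECT.  `E3Z.zL2d4C0half_quadH` (tree module `E3Cert/ZL2d4C0half/D_qh.lean`) is the integer polynomial `M·vᵀH(x)v`, `M = 2²¹`, in the
variables `x` = the quaternion coordinates of the 17 non-tree links of the 2⁴ block (indices `4t … 4t+3`, `t < 17`, corner taxi-tree gauge,
axis 0 first) and `v ∈ ℝ⁶⁴` = an ℍ-valued test field on the 16 sites (index `68 + 4s + c`, site `s` in lexicographic order, quaternion
component `c`).  THE POINT `vortexCoarse` ∕ `vortexSharp`: every link quaternion is `(±1, 0, 0, 0)` (so every sphere constraint
`|x_t|² = 1` holds), with `−1` exactly on the 7 direction-0 links `⟨x, x + e₀⟩`, `x₀ = 0`, `(x₁,x₂,x₃) ≠ 0` — the tree-gauge image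
`u′_b = g(b₋)u_b g(b₊)⁻¹`, `g(x) = (−1)^{x₀}`, of the configuration with the SINGLE corner link `⟨0, e₀⟩` equal to `−1` (same 3 frustrated
plaquettes); the test field is real (`c = 0` component only): coarse witness `w(x) = ±(2,3,3,4,3,4,4,4)` (sign `(−1)^{x₀}`, value by
`(x₁,x₂,x₃)`), Rayleigh quotient `136∕190`; sharp witness `w = ±(527, 852, 852, 949, 852, 949, 949, 1000)` (the λ_min-eigenvector rounded
to 10⁻³), quotient `7492720∕12314488 = 0.608447…`.

HOW IT IS CHECKED.  `evalZ` is the integer evaluation of the lane's sparse polynomials (`E3Z.Poly`), `Poly.eval_intCast` its agreement with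
the real evaluation `E3Z.Poly.eval` at integer points; the three numerical facts (`evalZ quadH = 285212672 = M·136`, `Σv² = 190`, all 17
sphere polynomials vanish; and the sharp analogues) are `decide +kernel` evaluations of the tree's literal data — nothing is recomputed or
re-emitted.  CROSS-CHECK OUTSIDE THE KERNEL (seat folder `work/vortex/vortex_witness.py`, pure-python exact rationals, an implementation of
(1.3)–(1.6) INDEPENDENT of the lane's `bal_e3_lattice.py`): `M·wᵀH w` computed from the definitions equals the kernel's `evalZ` value
(285212672), for all four placements of the real component, and inverse iteration reproduces λ_min = 0.6084460056.

WHAT THIS MODULE IS NOT.  No dictionary lemma «`quadH` = `vᵀ(B4GaugeCovariance.covOp …)v`» is proved here (that identification is the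
lane's documented emitter convention, `E3Cert/E3PolyCertZDefs` docstring, and is open tree-side for ALL E3 packages alike); no claim about
k ≥ 2, other blocks, the adjoint representation (numerically also failing at (4,2,1): descent 0.698) or Bałaban's small-field class.
v1.1 (DOCFIX, docstring-only; every declaration byte-identical to v1 = p338575): the d = 2, 3 certificate constants named exactly (1021∕1024 for
(2,2,1); 511∕512 for (2,3,1), (3,2,1)); the comparison sentence of `quadH_lt_normSq_at_vortex` likewise.
-/

namespace Summit.QuantumFields.BalabanUV.Gaps.E3Vortex

open E3Z

/-! ## §1 Integer evaluation of the lane's sparse polynomials -/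

/-- integer evaluation of a sparse monomial `[(v₁,e₁),…]` at an integer point: `Π X(vᵢ)^eᵢ` (mirror of `E3Z.Poly.evalMono`). [folklore] -/
def evalMonoZ (X : ℕ → ℤ) : Mono → ℤ
  | [] => 1
  | ve :: m => X ve.1 ^ ve.2 * evalMonoZ X m

/-- integer evaluation of a sparse integer polynomial at an integer point (mirror of `E3Z.Poly.eval`). [folklore] -/
def evalZ (X : ℕ → ℤ) : Poly → ℤ
  | [] => 0
  | mc :: p => mc.2 * evalMonoZ X mc.1 + evalZ X p

/-- `E3Z.Poly.evalMono` at an integer point is the cast of `evalMonoZ`. [folklore] -/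
theorem Poly.evalMono_intCast (X : ℕ → ℤ) (m : Mono) :
    Poly.evalMono (fun i => ((X i : ℤ) : ℝ)) m = ((evalMonoZ X m : ℤ) : ℝ) := by
  induction m with
  | nil => simp [Poly.evalMono, evalMonoZ]
  | cons ve m ih => simp [Poly.evalMono, evalMonoZ, ih]

/-- `E3Z.Poly.eval` at an integer point is the cast of `evalZ`. [folklore] -/
theorem Poly.eval_intCast (X : ℕ → ℤ) (p : Poly) :
    Poly.eval (fun i => ((X i : ℤ) : ℝ)) p = ((evalZ X p : ℤ) : ℝ) := by
  induction p with
  | nil => simp [Poly.eval, evalZ]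
  | cons mc p ih => simp [Poly.eval, evalZ, ih, Poly.evalMono_intCast]

/-- membership form: if every entry of `l.map (evalZ X ∘ Prod.fst)` tests `== 0`, the real evaluations vanish on `l`. [folklore] -/
theorem eval_fst_eq_zero_of_all {β : Type} (X : ℕ → ℤ) (l : List (Poly × β))
    (h : (l.all fun ew => evalZ X ew.1 == 0) = true) :
    ∀ ew ∈ l, Poly.eval (fun i => ((X i : ℤ) : ℝ)) ew.1 = 0 := by
  intro ew hew
  have h1 := List.all_eq_true.mp h ew hew
  rw [Poly.eval_intCast, beq_iff_eq.mp h1, Int.cast_zero]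

/-! ## §2 The ℤ₂-vortex points (integer tables; index convention in the module docstring) -/

/-- COARSE vortex point: links `(±1,0,0,0)` (−1 on the 7 tree-gauge vortex links, variables 0,12,20,28,32,40,44), real test field
`w = ±(2,3,3,4,3,4,4,4)` on the 16 sites (variables `68 + 4s`); all other variables 0. [folklore] -/
def vortexCoarse : List ℤ :=
  [-1, 0, 0, 0, 1, 0, 0, 0, 1, 0, 0, 0, -1, 0, 0, 0, 1, 0, 0, 0, -1, 0, 0, 0, 1, 0, 0, 0, -1, 0, 0, 0, -1, 0, 0, 0, 1, 0, 0, 0, -1, 0, 0, 0, -1, 0, 0, 0, 1, 0, 0, 0, 1, 0, 0, 0, 1, 0, 0, 0, 1, 0, 0, 0, 1, 0, 0, 0, 2, 0, 0, 0, 3, 0, 0, 0, 3, 0, 0, 0, 4, 0, 0, 0, 3, 0, 0, 0, 4, 0, 0, 0, 4, 0, 0, 0, 4, 0, 0, 0, -2, 0, 0, 0, -3, 0, 0, 0, -3, 0, 0, 0, -4, 0, 0, 0, -3, 0, 0, 0, -4, 0, 0, 0, -4, 0, 0, 0, -4, 0, 0, 0]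

/-- SHARP vortex point: same links, test field = the λ_min-eigenvector rounded to 10⁻³, `w = ±(527,852,852,949,852,949,949,1000)`. [folklore] -/
def vortexSharp : List ℤ :=
  [-1, 0, 0, 0, 1, 0, 0, 0, 1, 0, 0, 0, -1, 0, 0, 0, 1, 0, 0, 0, -1, 0, 0, 0, 1, 0, 0, 0, -1, 0, 0, 0, -1, 0, 0, 0, 1, 0, 0, 0, -1, 0, 0, 0, -1, 0, 0, 0, 1, 0, 0, 0, 1, 0, 0, 0, 1, 0, 0, 0, 1, 0, 0, 0, 1, 0, 0, 0, 527, 0, 0, 0, 852, 0, 0, 0, 852, 0, 0, 0, 949, 0, 0, 0, 852, 0, 0, 0, 949, 0, 0, 0, 949, 0, 0, 0, 1000, 0, 0, 0, -527, 0, 0, 0, -852, 0, 0, 0, -852, 0, 0, 0, -949, 0, 0, 0, -852, 0, 0, 0, -949, 0, 0, 0, -949, 0, 0, 0, -1000, 0, 0, 0]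

/-- the coarse point as an assignment `ℕ → ℤ` (0 beyond the table). [folklore] -/
def Xc (i : ℕ) : ℤ := vortexCoarse.getD i 0

/-- the sharp point as an assignment `ℕ → ℤ`. [folklore] -/
def Xs (i : ℕ) : ℤ := vortexSharp.getD i 0

/-! ## §3 Kernel evaluations (`decide +kernel` on the tree's literal data) -/

/-- `M·wᵀH(x)w = 285212672 = 2²¹·136` at the coarse vortex point. [folklore] -/
theorem evalZ_quadH_coarse : evalZ Xc zL2d4C0half.quadH = 285212672 := by
  decide +kernel

/-- `Σ v² = 190` at the coarse point. [folklore] -/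
theorem evalZ_vSq_coarse :
    evalZ Xc ((List.range zL2d4C0half.dim).map (fun i => ([(zL2d4C0half.nx + i, 2)], (1 : ℤ)))) = 190 := by
  decide +kernel

/-- all 17 sphere polynomials `|x_t|² − 1` vanish at the coarse point. [folklore] -/
theorem sphere_coarse : (zL2d4C0half.eq.all fun ew => evalZ Xc ew.1 == 0) = true := by
  decide +kernel

/-- the small-field hypothesis of link `t = 0` (`2(x₀)₀ − 1 ≥ 0`, i.e. `(u₀)₀ ≥ ½`) evaluates to `−3` at the vortex: the point lies
OUTSIDE the certified class of `zL2d4C0half`. [folklore] -/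
theorem evalZ_hyp0_coarse : evalZ Xc (zL2d4C0half.ineq.getD 0 ([], ⟨[], 0, [], 0, []⟩, 0)).1 = -3 := by
  decide +kernel

/-- `M·wᵀH(x)w = 2²¹·7492720` at the sharp vortex point. [folklore] -/
theorem evalZ_quadH_sharp : evalZ Xs zL2d4C0half.quadH = 15713372733440 := by
  decide +kernel

/-- `Σ v² = 12314488` at the sharp point. [folklore] -/
theorem evalZ_vSq_sharp :
    evalZ Xs ((List.range zL2d4C0half.dim).map (fun i => ([(zL2d4C0half.nx + i, 2)], (1 : ℤ)))) = 12314488 := by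
  decide +kernel

/-- all 17 sphere polynomials vanish at the sharp point. [folklore] -/
theorem sphere_sharp : (zL2d4C0half.eq.all fun ew => evalZ Xs ew.1 == 0) = true := by
  decide +kernel

/-! ## §4 The statements -/

/-- the sphere constraints of `zL2d4C0half` hold at the coarse vortex point (real form). [folklore] -/
theorem sphere_coarse_real : ∀ ew ∈ zL2d4C0half.eq, Poly.eval (fun i => ((Xc i : ℤ) : ℝ)) ew.1 = 0 :=
  eval_fst_eq_zero_of_all Xc _ sphere_coarse

/-- the sphere constraints hold at the sharp vortex point (real form). [folklore] -/
theorem sphere_sharp_real : ∀ ew ∈ zL2d4C0half.eq, Poly.eval (fun i => ((Xs i : ℤ) : ℝ)) ew.1 = 0 :=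
  eval_fst_eq_zero_of_all Xs _ sphere_sharp

/-- **THE ALL-U BOUND WITH γ₀ = a = 1 FAILS ON THE 2⁴ BLOCK**: at the ℤ₂ vortex, `vᵀH(x)v < 1·|v|²` (in the lane's integer currency:
`quadH < M·Σv²`, `136 < 190`).  Compare d = 2, 3, where `γ = 1021∕1024` ∕ `511∕512` is kernel-certified for ALL U (`E3Z.zL2d2AllU_nonneg` ∕ `zL3d2AllU_nonneg`, `zL2d3AllU_nonneg`).
[cite: Balaban1983RegularityDecay, p. 573 (1.8)] -/
theorem quadH_lt_normSq_at_vortex :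
    Poly.eval (fun i => ((Xc i : ℤ) : ℝ)) zL2d4C0half.quadH
      < (zL2d4C0half.M : ℝ) * Poly.eval (fun i => ((Xc i : ℤ) : ℝ))
          ((List.range zL2d4C0half.dim).map (fun i => ([(zL2d4C0half.nx + i, 2)], (1 : ℤ)))) := by
  rw [Poly.eval_intCast, Poly.eval_intCast, evalZ_quadH_coarse, evalZ_vSq_coarse]
  norm_num [zL2d4C0half]

/-- **EVEN THE SMALL-FIELD CERTIFICATE'S γ = 923∕1024 FAILS AT THE VORTEX** (which violates its hypotheses, `evalZ_hyp0_coarse`):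
`quadH < gamma·Σv²` at the coarse point (`2²¹·136 < 1890304·190`). [folklore] -/
theorem quadH_lt_gamma_normSq_at_vortex :
    Poly.eval (fun i => ((Xc i : ℤ) : ℝ)) zL2d4C0half.quadH
      < (zL2d4C0half.gamma : ℝ) * Poly.eval (fun i => ((Xc i : ℤ) : ℝ))
          ((List.range zL2d4C0half.dim).map (fun i => ([(zL2d4C0half.nx + i, 2)], (1 : ℤ)))) := by
  rw [Poly.eval_intCast, Poly.eval_intCast, evalZ_quadH_coarse, evalZ_vSq_coarse]
  norm_num [zL2d4C0half]

/-- **THE SMALL-FIELD HYPOTHESES OF `E3Z.zL2d4C0half_nonneg` ARE LOAD-BEARING**: its conclusion `0 ≤ quadH − gamma·Σv²` does NOT hold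
for every real point satisfying the sphere constraints alone (witness: the ℤ₂ vortex). [cite: Balaban1983RegularityDecay, p. 573 (1.8)] -/
theorem smallField_hypothesis_necessary :
    ¬ ∀ X : ℕ → ℝ, (∀ ew ∈ zL2d4C0half.eq, Poly.eval X ew.1 = 0) →
      0 ≤ Poly.eval X zL2d4C0half.quadH - (zL2d4C0half.gamma : ℝ) *
        Poly.eval X ((List.range zL2d4C0half.dim).map (fun i => ([(zL2d4C0half.nx + i, 2)], (1 : ℤ)))) := by
  intro h
  have h1 := h _ sphere_coarse_real
  have h2 := quadH_lt_gamma_normSq_at_vortex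
  linarith

/-- consistency: the vortex point violates the certificate's small-field hypothesis list (link 0: value −3 < 0), so
`E3Z.zL2d4C0half_nonneg` is not contradicted. [folklore] -/
theorem vortex_outside_smallField_class :
    ∃ gi ∈ zL2d4C0half.ineq, Poly.eval (fun i => ((Xc i : ℤ) : ℝ)) gi.1 < 0 := by
  refine ⟨zL2d4C0half.ineq.getD 0 ([], ⟨[], 0, [], 0, []⟩, 0), ?_, ?_⟩
  · rw [List.getD_eq_getElem _ _ (by rw [zL2d4C0half_len_ineq]; norm_num)]
    exact List.getElem_mem _
  · rw [Poly.eval_intCast, evalZ_hyp0_coarse]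
    norm_num

/-- **QUANTITATIVE FORM**: at the sharp vortex point the Rayleigh quotient `vᵀH(x)v ∕ |v|²` is `≤ 0.60845` (exactly
`7492720∕12314488 = 0.6084475…`; the lane's λ_min is 0.6084460056…). [folklore] -/
theorem rayleigh_le_at_sharp_vortex :
    Poly.eval (fun i => ((Xs i : ℤ) : ℝ)) zL2d4C0half.quadH
      ≤ (60845 / 100000 : ℝ) * ((zL2d4C0half.M : ℝ) * Poly.eval (fun i => ((Xs i : ℤ) : ℝ))
          ((List.range zL2d4C0half.dim).map (fun i => ([(zL2d4C0half.nx + i, 2)], (1 : ℤ))))) := by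
  rw [Poly.eval_intCast, Poly.eval_intCast, evalZ_quadH_sharp, evalZ_vSq_sharp]
  norm_num [zL2d4C0half]

/-- the same point certifies failure of EVERY uniform constant `γ > 0.60845` for the all-U form on this block:
`¬ (γ·M·Σv² ≤ quadH)` at the sharp vortex. [folklore] -/
theorem allU_bound_fails_above (γ : ℝ) (hγ : (60845 / 100000 : ℝ) < γ) :
    ¬ γ * ((zL2d4C0half.M : ℝ) * Poly.eval (fun i => ((Xs i : ℤ) : ℝ))
          ((List.range zL2d4C0half.dim).map (fun i => ([(zL2d4C0half.nx + i, 2)], (1 : ℤ)))))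
        ≤ Poly.eval (fun i => ((Xs i : ℤ) : ℝ)) zL2d4C0half.quadH := by
  intro h
  have h1 := rayleigh_le_at_sharp_vortex
  have hM : (zL2d4C0half.M : ℝ) = 2097152 := by norm_num [zL2d4C0half]
  rw [Poly.eval_intCast, Poly.eval_intCast, evalZ_quadH_sharp, evalZ_vSq_sharp, hM] at h h1
  push_cast at h h1
  nlinarith

end Summit.QuantumFields.BalabanUV.Gaps.E3Vortex
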